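import Summits.CriticalPhenomena.CardyFormulaZ2.Theorems.CardyFlipRussoVoronoiHubFromSmirnovCrossEventLocal
import Summits.CriticalPhenomena.CardyFormulaZ2.Theorems.CardyFlipRussoVoronoiHubFromSmirnovVoidNearDisc
import Summits.CriticalPhenomena.CardyFormulaZ2.Theorems.CardyFlipRussoVoronoiHubFromSmirnovWardFarField
import Summits.CriticalPhenomena.CardyFormulaZ2.Theorems.CardyFlipRussoVoronoiHubFromSmirnovStubIdentificationCovariance

/-!
# Stub `homCrossProb_restrict_tendsto` of line `moebius-exact-delaunay-dilation-ward`
# (crux `VoronoiHubFromSmirnov`, stmt-CriticalPhenomena-6433)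

A brick of S3a (the conformal-transport coupling): **the homogeneous crossing event ignores the
nuclei outside `W/δ` with high probability.**  For a conformal rectangle `S` and an open
neighbourhood `W ⊇ closure Ω` (`Ω = S.carrier`), reading the crossing event `crossEvent S δ` only
on the nuclei `b` whose physical position `δ b` lies in `W` (i.e. on the restricted pair
`(c.1|_{W/δ}, c.2|_{W/δ})`) changes its probability under the two-colour homogeneous Poisson law
`lawBW volume` by `o(1)` as `δ → 0⁺`.

Proof.  `closure Ω` is compact inside the open `W`, so `thickening d₀ (closure Ω) ⊆ W` for some
`d₀ > 0`, and `closure Ω ⊆ closedBall 0 ρ₀` with `ρ₀ ≥ d₀`.  In configuration coordinates put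
`D = (· / δ) '' closure Ω` and `s = d₀ / (3δ)`: the open `2s`-thickening of `D` lies inside
`{b | δ b ∈ W}`, so a pair `c` and its restriction agree there, and by the landed locality of the
crossing event (`crossEvent_iff_of_local`) the two events agree OFF the bad event "some point of
`D` has no black (resp. no white) nucleus within distance `< s`".  Hence (outer-measure
monotonicity, `abs_measureReal_sub_le_of_iff`) the two probabilities differ by at most the
probability of the bad event, whose two colour halves are marginals of the product law, i.e.
genuine Poisson probabilities (`isPoissonPointProcess_poissonLaw_volume`), each bounded by the landed
no-giant-cells estimate `poisson_voidNear_disc_le`: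
`≤ (36 ρ₀ / d₀ + 1)² · exp (-π d₀² / (81 δ²)) → 0` as `δ → 0⁺`.

References: I. Benjamini, O. Schramm, *Conformal invariance of Voronoi percolation*, Comm. Math.
Phys. 197 (1998) 75–107, Lemma 5.5 and §3; B. Bollobás, O. Riordan, *Percolation* (CUP 2006), Ch. 8
(locality of the Voronoi crossing event).  No new definitions; tree facts and Mathlib only.
-/

noncomputable section

namespace Summit.CriticalPhenomena.CardyFormulaZ2.Cruxes.VoronoiHubFromSmirnov.MoebiusExactDelaunayDilationWard

open scoped Topology ENNReal
open Filter Set MeasureTheory Metric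
open Literature.Analysis.FunctionSpaces
open Literature.Probability.RandomPlanarGeometry

/-! ### Geometry: configuration versus physical coordinates -/

/-- Scaling of distances between configuration and physical coordinates: for a mesh `δ > 0`,
`dist (δ p) k = δ · dist p (k / δ)`. -/
theorem rl_dist_mul_left {δ : ℝ} (hδ : 0 < δ) (p k : ℂ) :
    dist ((δ : ℂ) * p) k = δ * dist p (k / (δ : ℂ)) := by
  have hδc : ‖(δ : ℂ)‖ = δ := Complex.norm_of_nonneg hδ.le
  have hδ0 : (δ : ℂ) ≠ 0 := Complex.ofReal_ne_zero.2 hδ.ne'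
  conv_lhs => rw [← mul_div_cancel₀ k hδ0]
  rw [dist_eq_norm, dist_eq_norm, ← mul_sub, norm_mul, hδc]

/-- A point of the open `t`-thickening of `K/δ` (configuration coordinates) has its physical
position `δ p` in the open `δ t`-thickening of `K`. -/
theorem rl_mul_mem_thickening {δ : ℝ} (hδ : 0 < δ) {t : ℝ} {K : Set ℂ} {p : ℂ}
    (hp : p ∈ thickening t ((fun z : ℂ => z / (δ : ℂ)) '' K)) :
    (δ : ℂ) * p ∈ thickening (δ * t) K := by
  obtain ⟨z, hz, hpz⟩ := mem_thickening_iff.1 hp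
  obtain ⟨k, hk, rfl⟩ := hz
  rw [mem_thickening_iff]
  refine ⟨k, hk, ?_⟩
  rw [rl_dist_mul_left hδ]
  exact mul_lt_mul_of_pos_left hpz hδ

/-- With `s = d₀ / (3δ)`, the open `2s`-thickening of `(closure Ω)/δ` consists of nuclei whose
physical position lies in `thickening d₀ (closure Ω) ⊆ W`. -/
theorem rl_thickening_subset (K : Set ℂ) {W : Set ℂ} {d₀ δ : ℝ} (hδ : 0 < δ)
    (hKW : thickening d₀ K ⊆ W) :
    thickening (2 * (d₀ / (3 * δ))) ((fun z : ℂ => z / (δ : ℂ)) '' K) ⊆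
      {b : ℂ | (δ : ℂ) * b ∈ W} := by
  intro p hp
  have hp' := rl_mul_mem_thickening hδ hp
  have hδ0 : δ ≠ 0 := hδ.ne'
  have h : δ * (2 * (d₀ / (3 * δ))) = 2 / 3 * d₀ := by
    field_simp
  rw [h] at hp'
  rcases le_or_gt d₀ 0 with h0 | h0
  · rw [thickening_of_nonpos (by linarith : 2 / 3 * d₀ ≤ 0)] at hp'
    exact (Set.notMem_empty _ hp').elim
  · exact hKW (thickening_mono (by linarith : 2 / 3 * d₀ ≤ d₀) _ hp')

/-! ### Locality: the restricted pair crosses iff the pair crosses, off the bad event -/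

/-- **Deterministic core.**  If every point of `D = (closure Ω)/δ` has a black AND a white nucleus
within distance `< s = d₀/(3δ)`, and `thickening d₀ (closure Ω) ⊆ W`, then the pair `c` restricted
to `{b | δ b ∈ W}` lies in `crossEvent S δ` iff `c` does (`crossEvent_iff_of_local`: the two pairs
agree inside the open `2s`-thickening of `D`). -/
theorem rl_restrict_mem_crossEvent_iff (S : ConformalRectangle) {W : Set ℂ} {d₀ δ : ℝ}
    (hδ : 0 < δ) (hKW : thickening d₀ (closure S.carrier) ⊆ W) (c : PointConfig ℂ × PointConfig ℂ)
    (h₁ : ∀ z ∈ (fun z : ℂ => z / (δ : ℂ)) '' closure S.carrier, ∃ q ∈ c.1,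
      dist q z < d₀ / (3 * δ))
    (h₂ : ∀ z ∈ (fun z : ℂ => z / (δ : ℂ)) '' closure S.carrier, ∃ q ∈ c.2,
      dist q z < d₀ / (3 * δ)) :
    (PointConfig.restrict {b : ℂ | (δ : ℂ) * b ∈ W} c.1,
        PointConfig.restrict {b : ℂ | (δ : ℂ) * b ∈ W} c.2) ∈ crossEvent S δ ↔
      c ∈ crossEvent S δ := by
  have hTA := rl_thickening_subset (closure S.carrier) hδ hKW
  obtain ⟨z₀, hz₀⟩ : ((fun z : ℂ => z / (δ : ℂ)) '' closure S.carrier).Nonempty :=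
    (S.nonempty.mono subset_closure).image _
  have hs0 : 0 < d₀ / (3 * δ) := by
    obtain ⟨q, -, hq⟩ := h₁ z₀ hz₀
    exact lt_of_le_of_lt dist_nonneg hq
  -- nonemptiness of the four configurations
  have hne₁ : (c.1 : Set ℂ).Nonempty := by
    obtain ⟨q, hq, -⟩ := h₁ z₀ hz₀
    exact ⟨q, hq⟩
  have hne₂ : (c.2 : Set ℂ).Nonempty := by
    obtain ⟨q, hq, -⟩ := h₂ z₀ hz₀
    exact ⟨q, hq⟩
  have hmemT : ∀ q : ℂ, dist q z₀ < d₀ / (3 * δ) →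
      q ∈ thickening (2 * (d₀ / (3 * δ))) ((fun z : ℂ => z / (δ : ℂ)) '' closure S.carrier) :=
    fun q hq => mem_thickening_iff.2 ⟨z₀, hz₀, by linarith⟩
  have hne₁' : ((PointConfig.restrict {b : ℂ | (δ : ℂ) * b ∈ W} c.1 : PointConfig ℂ) :
      Set ℂ).Nonempty := by
    obtain ⟨q, hq, hqz⟩ := h₁ z₀ hz₀
    refine ⟨q, ?_⟩
    rw [PointConfig.coe_eq_carrier, PointConfig.carrier_restrict]
    exact ⟨hq, hTA (hmemT q hqz)⟩
  have hne₂' : ((PointConfig.restrict {b : ℂ | (δ : ℂ) * b ∈ W} c.2 : PointConfig ℂ) :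
      Set ℂ).Nonempty := by
    obtain ⟨q, hq, hqz⟩ := h₂ z₀ hz₀
    refine ⟨q, ?_⟩
    rw [PointConfig.coe_eq_carrier, PointConfig.carrier_restrict]
    exact ⟨hq, hTA (hmemT q hqz)⟩
  -- agreement inside the thickening
  have hag₁ : (c.1 : Set ℂ) ∩
      thickening (2 * (d₀ / (3 * δ))) ((fun z : ℂ => z / (δ : ℂ)) '' closure S.carrier) =
      ((PointConfig.restrict {b : ℂ | (δ : ℂ) * b ∈ W} c.1 : PointConfig ℂ) : Set ℂ) ∩
      thickening (2 * (d₀ / (3 * δ))) ((fun z : ℂ => z / (δ : ℂ)) '' closure S.carrier) := by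
    rw [PointConfig.coe_eq_carrier, PointConfig.coe_eq_carrier, PointConfig.carrier_restrict,
      Set.inter_assoc, Set.inter_eq_right.2 hTA]
  have hag₂ : (c.2 : Set ℂ) ∩
      thickening (2 * (d₀ / (3 * δ))) ((fun z : ℂ => z / (δ : ℂ)) '' closure S.carrier) =
      ((PointConfig.restrict {b : ℂ | (δ : ℂ) * b ∈ W} c.2 : PointConfig ℂ) : Set ℂ) ∩
      thickening (2 * (d₀ / (3 * δ))) ((fun z : ℂ => z / (δ : ℂ)) '' closure S.carrier) := by
    rw [PointConfig.coe_eq_carrier, PointConfig.coe_eq_carrier, PointConfig.carrier_restrict,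
      Set.inter_assoc, Set.inter_eq_right.2 hTA]
  -- every point of `closure Ω / δ` has a nucleus within `< s`
  have hK : ∀ z ∈ closure S.carrier,
      infDist (z / (δ : ℂ)) ((c.1 : Set ℂ) ∪ (c.2 : Set ℂ)) < d₀ / (3 * δ) := by
    intro z hz
    obtain ⟨q, hq, hqz⟩ := h₁ (z / (δ : ℂ)) (mem_image_of_mem _ hz)
    calc infDist (z / (δ : ℂ)) ((c.1 : Set ℂ) ∪ (c.2 : Set ℂ))
        ≤ dist (z / (δ : ℂ)) q := infDist_le_dist_of_mem (mem_union_left _ hq)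
      _ = dist q (z / (δ : ℂ)) := dist_comm _ _
      _ < d₀ / (3 * δ) := hqz
  exact (crossEvent_iff_of_local S δ (d₀ / (3 * δ)) c
    (PointConfig.restrict {b : ℂ | (δ : ℂ) * b ∈ W} c.1,
      PointConfig.restrict {b : ℂ | (δ : ℂ) * b ∈ W} c.2)
    hδ hne₁ hne₂ hne₁' hne₂' hag₁ hag₂ hK).symm

/-! ### Probability: marginals of the two-colour law and the bound -/

/-- The BLACK marginal of `lawBW volume` is `poissonLaw volume` (for every set `E`). -/
theorem rl_lawBW_real_fst (E : Set (PointConfig ℂ)) :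
    (lawBW (volume : Measure ℂ)).real {c : PointConfig ℂ × PointConfig ℂ | c.1 ∈ E} =
      (poissonLaw (volume : Measure ℂ)).real E := by
  haveI := isPoissonPointProcess_poissonLaw_volume.isProbabilityMeasure
  have hset : {c : PointConfig ℂ × PointConfig ℂ | c.1 ∈ E} = E ×ˢ (univ : Set (PointConfig ℂ)) := by
    ext c
    simp only [mem_setOf_eq, mem_prod, mem_univ, and_true]
  rw [hset, lawBW, measureReal_prod_prod, probReal_univ, mul_one]

/-- The WHITE marginal of `lawBW volume` is `poissonLaw volume` (for every set `E`). -/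
theorem rl_lawBW_real_snd (E : Set (PointConfig ℂ)) :
    (lawBW (volume : Measure ℂ)).real {c : PointConfig ℂ × PointConfig ℂ | c.2 ∈ E} =
      (poissonLaw (volume : Measure ℂ)).real E := by
  haveI := isPoissonPointProcess_poissonLaw_volume.isProbabilityMeasure
  have hset : {c : PointConfig ℂ × PointConfig ℂ | c.2 ∈ E} = (univ : Set (PointConfig ℂ)) ×ˢ E := by
    ext c
    simp only [mem_setOf_eq, mem_prod, mem_univ, true_and]
  rw [hset, lawBW, measureReal_prod_prod, probReal_univ, one_mul]

/-- **The bound at a fixed mesh.**  If `thickening d₀ (closure Ω) ⊆ W`,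
`closure Ω ⊆ closedBall 0 ρ₀` and `0 < d₀ ≤ ρ₀`, then for every `δ > 0` the probabilities of the
restricted and the unrestricted crossing events differ by at most
`2 (36 ρ₀ / d₀ + 1)² exp (-π (d₀ / (9δ))²)` (no giant cells, for each colour). -/
theorem rl_abs_sub_le (S : ConformalRectangle) {W : Set ℂ} {d₀ ρ₀ δ : ℝ} (hd₀ : 0 < d₀)
    (hδ : 0 < δ) (hdρ : d₀ ≤ ρ₀) (hKW : thickening d₀ (closure S.carrier) ⊆ W)
    (hKρ : closure S.carrier ⊆ closedBall 0 ρ₀) :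
    |(lawBW (volume : Measure ℂ)).real {c | (PointConfig.restrict {b : ℂ | (δ : ℂ) * b ∈ W} c.1,
        PointConfig.restrict {b : ℂ | (δ : ℂ) * b ∈ W} c.2) ∈ crossEvent S δ} - homCrossProb S δ|
      ≤ 2 * ((36 * ρ₀ / d₀ + 1) ^ 2 * Real.exp (-(Real.pi * (d₀ / 9 * δ⁻¹) ^ 2))) := by
  haveI := isProbabilityMeasure_lawBW_volume
  have hδ0 : δ ≠ 0 := hδ.ne'
  have hs0 : 0 < d₀ / (3 * δ) := by positivity
  set D : Set ℂ := (fun z : ℂ => z / (δ : ℂ)) '' closure S.carrier with hD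
  set E : Set (PointConfig ℂ) := {c₁ | ∃ z ∈ D, ∀ q ∈ c₁, d₀ / (3 * δ) ≤ dist q z} with hE
  -- off the bad event the two events agree
  have hgood : ∀ c : PointConfig ℂ × PointConfig ℂ,
      c ∉ ({c : PointConfig ℂ × PointConfig ℂ | c.1 ∈ E} ∪ {c | c.2 ∈ E}) →
      (c ∈ {c : PointConfig ℂ × PointConfig ℂ |
        (PointConfig.restrict {b : ℂ | (δ : ℂ) * b ∈ W} c.1,
          PointConfig.restrict {b : ℂ | (δ : ℂ) * b ∈ W} c.2) ∈ crossEvent S δ} ↔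
        c ∈ crossEvent S δ) := by
    intro c hc
    simp only [mem_union, mem_setOf_eq, hE, not_or] at hc
    push Not at hc
    exact rl_restrict_mem_crossEvent_iff S hδ hKW c hc.1 hc.2
  have h1 := abs_measureReal_sub_le_of_iff (lawBW volume) _ (crossEvent S δ) _ hgood
  -- the bad event of one colour is a no-giant-cells event of a genuine Poisson process
  have hE_le : (poissonLaw (volume : Measure ℂ)).real E ≤
      (36 * ρ₀ / d₀ + 1) ^ 2 * Real.exp (-(Real.pi * (d₀ / 9 * δ⁻¹) ^ 2)) := by
    have hsρ : d₀ / (3 * δ) ≤ 3 * (ρ₀ / δ) := by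
      have h9 : 3 * (ρ₀ / δ) * (3 * δ) = 9 * ρ₀ := by
        field_simp
        ring
      rw [div_le_iff₀ (by positivity), h9]
      linarith
    have hDρ : D ⊆ closedBall 0 (ρ₀ / δ) := by
      rintro _ ⟨k, hk, rfl⟩
      have hk' := mem_closedBall_zero_iff.1 (hKρ hk)
      show k / (δ : ℂ) ∈ closedBall (0 : ℂ) (ρ₀ / δ)
      rw [mem_closedBall_zero_iff, norm_div, Complex.norm_of_nonneg hδ.le]
      exact div_le_div_of_nonneg_right hk' hδ.le
    have h := poisson_voidNear_disc_le isPoissonPointProcess_poissonLaw_volume D (ρ₀ / δ)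
      (d₀ / (3 * δ)) hs0 hsρ hDρ
    have e1 : 12 * (ρ₀ / δ) / (d₀ / (3 * δ)) = 36 * ρ₀ / d₀ := by
      field_simp
      ring
    have e2 : d₀ / (3 * δ) / 3 = d₀ / 9 * δ⁻¹ := by
      field_simp
      ring
    rw [e1, e2] at h
    exact h
  unfold homCrossProb
  calc |(lawBW (volume : Measure ℂ)).real {c | (PointConfig.restrict {b : ℂ | (δ : ℂ) * b ∈ W} c.1,
          PointConfig.restrict {b : ℂ | (δ : ℂ) * b ∈ W} c.2) ∈ crossEvent S δ} -
          (lawBW (volume : Measure ℂ)).real (crossEvent S δ)|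
      ≤ (lawBW (volume : Measure ℂ)).real
          ({c : PointConfig ℂ × PointConfig ℂ | c.1 ∈ E} ∪ {c | c.2 ∈ E}) := h1
    _ ≤ (lawBW (volume : Measure ℂ)).real {c : PointConfig ℂ × PointConfig ℂ | c.1 ∈ E} +
          (lawBW (volume : Measure ℂ)).real {c : PointConfig ℂ × PointConfig ℂ | c.2 ∈ E} :=
        measureReal_union_le _ _
    _ = 2 * (poissonLaw (volume : Measure ℂ)).real E := by
        rw [rl_lawBW_real_fst, rl_lawBW_real_snd]
        ring
    _ ≤ 2 * ((36 * ρ₀ / d₀ + 1) ^ 2 * Real.exp (-(Real.pi * (d₀ / 9 * δ⁻¹) ^ 2))) :=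
        mul_le_mul_of_nonneg_left hE_le (by norm_num)

/-! ### The stub -/

/-- **The homogeneous crossing event ignores the nuclei outside `W/δ` with high probability**
(brick of S3a, the conformal-transport coupling; Benjamini–Schramm 1998 §3 with the no-giant-cells
Lemma 5.5, Bollobás–Riordan 2006 Ch. 8 locality): for an open `W ⊇ closure Ω`, restricting both
colours of the homogeneous two-colour Poisson nuclei to `{b | δ b ∈ W}` changes the probability of
the crossing event `crossEvent S δ` by `o(1)` as `δ → 0⁺`. -/
theorem homCrossProb_restrict_tendsto : ∀ (S : ConformalRectangle) (W : Set ℂ), IsOpen W → closure S.carrier ⊆ W → Filter.Tendsto (fun δ : ℝ => (lawBW (MeasureTheory.volume : MeasureTheory.Measure ℂ)).real {c | (Literature.Analysis.FunctionSpaces.PointConfig.restrict {b : ℂ | (δ : ℂ) * b ∈ W} c.1, Literature.Analysis.FunctionSpaces.PointConfig.restrict {b : ℂ | (δ : ℂ) * b ∈ W} c.2) ∈ crossEvent S δ} - homCrossProb S δ) (nhdsWithin (0 : ℝ) (Set.Ioi 0)) (nhds 0) := by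
  intro S W hW hKW
  have hK : IsCompact (closure S.carrier) := S.isBounded.isCompact_closure
  obtain ⟨d₀, hd₀, hthick⟩ := hK.exists_thickening_subset_open hW hKW
  obtain ⟨r, hr⟩ := hK.isBounded.subset_closedBall (0 : ℂ)
  have hKρ : closure S.carrier ⊆ closedBall 0 (max r d₀) :=
    hr.trans (closedBall_subset_closedBall (le_max_left _ _))
  set C : ℝ := 2 * (36 * max r d₀ / d₀ + 1) ^ 2 with hC
  refine squeeze_zero_norm' (a := fun δ : ℝ => C * Real.exp (-(Real.pi * (d₀ / 9 * δ⁻¹) ^ 2)))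
    ?_ ?_
  · filter_upwards [self_mem_nhdsWithin] with δ hδ
    rw [Real.norm_eq_abs]
    calc _ ≤ 2 * ((36 * max r d₀ / d₀ + 1) ^ 2 * Real.exp (-(Real.pi * (d₀ / 9 * δ⁻¹) ^ 2))) :=
          rl_abs_sub_le S hd₀ hδ (le_max_right r d₀) hthick hKρ
      _ = C * Real.exp (-(Real.pi * (d₀ / 9 * δ⁻¹) ^ 2)) := by
          rw [hC]
          ring
  · have h1 : Tendsto (fun δ : ℝ => d₀ / 9 * δ⁻¹) (𝓝[>] 0) atTop :=
      tendsto_inv_nhdsGT_zero.const_mul_atTop (by positivity)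
    have h2 : Tendsto (fun δ : ℝ => Real.pi * (d₀ / 9 * δ⁻¹) ^ 2) (𝓝[>] 0) atTop :=
      ((tendsto_pow_atTop two_ne_zero).comp h1).const_mul_atTop Real.pi_pos
    have h3 := (Real.tendsto_exp_neg_atTop_nhds_zero.comp h2).const_mul C
    rw [mul_zero] at h3
    exact h3

end Summit.CriticalPhenomena.CardyFormulaZ2.Cruxes.VoronoiHubFromSmirnov.MoebiusExactDelaunayDilationWard

end
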